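import Literature.AnabelianGeometry.EtaleTheta.ThetaCoversMonodromyModelAut
import Literature.AnabelianGeometry.EtaleTheta.ThetaCoversKummerTwistAutomorphism
import Mathlib.Data.Int.Cast.Lemmas
import HarnessLib

/-!
# The dotted members `Π^tp_{Ẋ̲̲}, Π^tp_{Ẋ̲}, Π^tp_{Ċ̲̲}, Π^tp_{Ċ̲}` of the monodromy model in coordinates, and the action
# of the automorphism family on them ([EtTh] §2, Def. 2.5 (ii), Prop. 2.6, Rmk. 2.6.1) — proof-only

S. Mochizuki, *The étale theta function and its Frobenioid-theoretic manifestations* [EtTh], Publ. RIMS **45**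
(2009), §2 Def. 2.5 (ii) (PDF p. 39: the dotted tower `Ẋ̲̲, Ẋ̲, Ċ̲̲, Ċ̲`), Prop. 2.6 and Rmk. 2.6.1 (p. 40)
[cite: MochizukiEtTh2009, Def 2.5(ii) p.39] [cite: MochizukiEtTh2009, Rmk 2.6.1 p.40].  Cell abc-iut, layer L2, seat
abc-iut-w6-d084 (gen 7), «P26-NV MONODROMY TOY» STAGE 2 FILE 4b (abc-iut-L2-lead R1352).  PROOF-ONLY companion of
`ThetaCoversMonodromyModelAut.lean` (no definition, no named fact; nothing of [EtTh] asserted).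

HONEST LABEL (R1352): a DESIGNED tempered toy with print's monodromy combinatorics; `G_K := 1`; NOT a Tate curve, NOT the
tempered fundamental group of a curve; consistency ≠ faithfulness; nothing here takes a side on anything printed.

CONTENT (coordinates `(b, c, d, e)` on `TG l = ((ℤ/l × ℤ/l) ⋊ D_∞) × ℤ/2`).  §1 The generators act on coordinates:
`conj(ι) : (b, c, d, e) ↦ (−b, c, s d s, e)`, `conj(x^a)`, and on the image of `embCu : ℤ/l × D_∞ ↪ TG l`
(`(c, d) ↦ ((0,c), d, 1)`): `scaleAut u`, `halfShift k`, `conj(ι)` map `embCu (c, d)` to `embCu (u c, d)`,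
`embCu (c, shift_k d)`, `embCu (c, s d s)`.  §2 The generators STABILISE the coordinate subgroups `{b = 0}` (`Π^tp_{C̲}`),
`{b = c = 0}` (`Π^tp_{C̲̲}`), their rotation parts (`Π^tp_{X̲}`, `Π^tp_{X̲̲}`) and `{e = 1}` (`Π^tp_Ċ`).  §3 The four dotted
members ARE the images of `ℤ/l × D_∞`, `ℤ/l × ⟨r⟩`, `D_∞`, `⟨r⟩` under `embCu` (ranges of injective homomorphisms), so that
automorphisms of the members transport to automorphisms of `ℤ/l × D_∞`, `ℤ/l × ℤ`, `D_∞`, `ℤ`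
(censused in `Discharge/Sec2MonodromyModelAutLemmas.lean`).  Sequel: `Discharge/Sec2Prop26TrueAtMonodromyModel.lean`.
-/

noncomputable section

namespace Literature.AnabelianGeometry.EtaleTheta.ThetaCovers.MonodromyModel

open Multiplicative HeisenbergWitness TemperedModel DihedralGroup
open KummerWitness (map_equiv_eq_of_iff)

variable (l : ℕ)

/-! ## 0. A generic helper (`map_equiv_eq_of_iff` is abc-iut-w5-d243's, `ThetaCoversKummerTwistAutomorphism`) -/

/-- Stabilisation is preserved by composition. (folklore helper; no claim about print) [cite: MochizukiEtTh2009, Prop 2.6 p.40] -/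
theorem map_trans_eq {G : Type*} [Group G] (e₁ e₂ : G ≃* G) (H : Subgroup G) (h₁ : H.map e₁.toMonoidHom = H)
    (h₂ : H.map e₂.toMonoidHom = H) : H.map (e₁.trans e₂).toMonoidHom = H := by
  rw [show (e₁.trans e₂).toMonoidHom = e₂.toMonoidHom.comp e₁.toMonoidHom from rfl, ← Subgroup.map_map, h₁, h₂]

/-! ## 1. The generators in coordinates -/

/-- **`conj(ι)` in coordinates**: `(b, c, d, e) ↦ (−b, c, s d s, e)` (the inversion inverts the `a`-cycle and the loop,
fixes `Δ̄_Θ`). (toy bookkeeping for [EtTh] Rmk. 2.1.1 / Prop. 2.6; no claim about print) [cite: MochizukiEtTh2009, Prop 2.6 p.40] -/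
theorem conj_iotaT_coords (g : TG l) :
    (MulAut.conj (iotaT l) g).1.right = sr 0 * g.1.right * sr 0 ∧ bC l (MulAut.conj (iotaT l) g) = -bC l g ∧
      cC l (MulAut.conj (iotaT l) g) = cC l g ∧ (MulAut.conj (iotaT l) g).2 = g.2 := by
  refine ⟨?_, ?_, ?_, ?_⟩
  · rw [MulAut.conj_apply, right_mul, right_mul, right_inv, (iotaT_coords l).1, inv_sr]
  · rw [MulAut.conj_apply, bC_mul, bC_mul, bC_inv, (iotaT_coords l).1, (iotaT_coords l).2.1]
    simp
  · rw [MulAut.conj_apply, cC_mul, cC_mul, cC_inv, bC_inv, (iotaT_coords l).1, (iotaT_coords l).2.1,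
      (iotaT_coords l).2.2.1]
    simp
  · rw [MulAut.conj_apply, snd_mul, snd_mul, snd_inv, (iotaT_coords l).2.2.2, one_mul, inv_one, mul_one]

/-- **`conj(x^a)` in coordinates**: `(b, c, d, e) ↦ (b + a (1 − ε(d)), c − i(d) a, d, e)`. (toy bookkeeping for [EtTh]
Prop. 2.6; no claim about print) [cite: MochizukiEtTh2009, Prop 2.6 p.40] -/
theorem conj_xElt_coords (a : ZMod l) (g : TG l) :
    (MulAut.conj (xElt l a) g).1.right = g.1.right ∧
      bC l (MulAut.conj (xElt l a) g) = bC l g + a * (1 - eps l (dihedralRed l g.1.right)) ∧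
      cC l (MulAut.conj (xElt l a) g) = cC l g - rotIdx l (dihedralRed l g.1.right) * a ∧
      (MulAut.conj (xElt l a) g).2 = g.2 := by
  refine ⟨?_, ?_, ?_, ?_⟩
  · rw [MulAut.conj_apply, right_mul, right_mul, right_inv, xElt_right, inv_one, one_mul, mul_one]
  · simp only [MulAut.conj_apply, bC_mul, bC_inv, right_mul, xElt_right, bC_xElt, map_one, eps_one, one_mul]
    ring
  · simp only [MulAut.conj_apply, cC_mul, cC_inv, bC_inv, right_mul, xElt_right, bC_xElt, cC_xElt, map_one,
      eps_one, rotIdx_one, inv_one, one_mul]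
    ring
  · rw [MulAut.conj_apply, snd_mul, snd_mul, snd_inv, xElt_snd, one_mul, inv_one, mul_one]

/-- `scaleAut u (embCu (c, d)) = embCu (u c, d)`. (toy bookkeeping for [EtTh] Rmk. 2.6.1 «`μ_l ⊆ Aut_K`»; no claim about
print) [cite: MochizukiEtTh2009, Rmk 2.6.1 p.40] -/
theorem scaleAut_embCu (u : (ZMod l)ˣ) (c : Multiplicative (ZMod l)) (d : DihedralGroup 0) :
    scaleAut l u (embCu l (c, d)) = embCu l (ofAdd ((u : ZMod l) * toAdd c), d) :=
  TG.ext l rfl (by rw [(scaleAut_coords l u _).2.1, bC_embCu, bC_embCu, mul_zero])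
    (by rw [(scaleAut_coords l u _).2.2.1, cC_embCu, cC_embCu, toAdd_ofAdd]) rfl

/-- `halfShift k (embCu (c, d)) = embCu (c, shift_k d)`. (toy bookkeeping for [EtTh] Prop. 2.6; no claim about print)
[cite: MochizukiEtTh2009, Prop 2.6 p.40] -/
theorem halfShift_embCu (hl : Odd l) (k : ZMod 0) (c : Multiplicative (ZMod l)) (d : DihedralGroup 0) :
    halfShift l hl k (embCu l (c, d)) = embCu l (c, dihedralShift k d) :=
  TG.ext l rfl (by rw [(halfShift_coords l hl k _).2.1, bC_embCu, bC_embCu])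
    (by rw [(halfShift_coords l hl k _).2.2.1, bC_embCu, mul_zero, add_zero, cC_embCu, cC_embCu]) rfl

/-- `conj(ι) (embCu (c, d)) = embCu (c, s d s)`. (toy bookkeeping for [EtTh] Prop. 2.6; no claim about print)
[cite: MochizukiEtTh2009, Prop 2.6 p.40] -/
theorem conj_iotaT_embCu (c : Multiplicative (ZMod l)) (d : DihedralGroup 0) :
    MulAut.conj (iotaT l) (embCu l (c, d)) = embCu l (c, sr 0 * d * sr 0) := by
  obtain ⟨h1, h2, h3, h4⟩ := conj_iotaT_coords l (embCu l (c, d))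
  exact TG.ext l (by rw [h1]; rfl) (by rw [h2]; simp) (by rw [h3]; rfl) (by rw [h4]; rfl)

/-- `s r^i s = r^{-i}` and `s (s r^i) s = s r^{-i}` in `D_∞`. (folklore; no claim about print) [cite: MochizukiEtTh2009, Prop 2.6 p.40] -/
theorem sr_conj_dihedral (i : ZMod 0) :
    sr 0 * r i * sr 0 = (r (-i) : DihedralGroup 0) ∧ sr 0 * sr i * sr 0 = (sr (-i) : DihedralGroup 0) := by
  constructor
  · rw [sr_mul_r, sr_mul_sr, zero_add, zero_sub]
  · rw [sr_mul_sr, r_mul_sr, sub_zero, zero_sub]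

/-! ## 2. Stabilisation of the coordinate subgroups -/

/-- Membership in the member subgroups by coordinates. (toy bookkeeping for [EtTh] Def. 2.5 (ii); no claim about print)
[cite: MochizukiEtTh2009, Def 2.5(ii) p.39] -/
theorem mem_members_iff (g : TG l) :
    (g ∈ (heisB0 l).comap (PhiT l) ↔ bC l g = 0) ∧
      (g ∈ (heisD l).comap (PhiT l) ↔ bC l g = 0 ∧ cC l g = 0) ∧
      (g ∈ (heisPiX l).comap (PhiT l) ↔ ∃ j, g.1.right = r j) ∧ (g ∈ PiCdotT l ↔ g.2 = 1) := by
  refine ⟨Iff.rfl, ?_, mem_comap_PhiT_heisPiX l, mem_PiCdotT l⟩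
  rw [mem_comap_PhiT_heisD]
  constructor
  · intro h; exact ⟨by simp [bC, h], by simp [cC, h]⟩
  · rintro ⟨h1, h2⟩; exact toAdd.injective (Prod.ext h1 h2)

/-- `scaleAut u` stabilises `{b = 0}`, `{b = c = 0}`, the rotations and `{e = 1}`. (toy bookkeeping for [EtTh] Prop. 2.6;
no claim about print) [cite: MochizukiEtTh2009, Prop 2.6 p.40] -/
theorem scaleAut_stabilises (u : (ZMod l)ˣ) :
    ((heisB0 l).comap (PhiT l)).map (scaleAut l u).toMonoidHom = (heisB0 l).comap (PhiT l) ∧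
      ((heisD l).comap (PhiT l)).map (scaleAut l u).toMonoidHom = (heisD l).comap (PhiT l) ∧
      ((heisPiX l).comap (PhiT l)).map (scaleAut l u).toMonoidHom = (heisPiX l).comap (PhiT l) ∧
      (PiCdotT l).map (scaleAut l u).toMonoidHom = PiCdotT l := by
  refine ⟨map_equiv_eq_of_iff _ _ fun g => ?_, map_equiv_eq_of_iff _ _ fun g => ?_,
    map_equiv_eq_of_iff _ _ fun g => ?_, map_equiv_eq_of_iff _ _ fun g => ?_⟩
  · rw [(mem_members_iff l _).1, (mem_members_iff l _).1, (scaleAut_coords l u g).2.1, Units.mul_right_eq_zero]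
  · rw [(mem_members_iff l _).2.1, (mem_members_iff l _).2.1, (scaleAut_coords l u g).2.1, (scaleAut_coords l u g).2.2.1,
      Units.mul_right_eq_zero, Units.mul_right_eq_zero]
  · rw [(mem_members_iff l _).2.2.1, (mem_members_iff l _).2.2.1, (scaleAut_coords l u g).1]
  · rw [(mem_members_iff l _).2.2.2, (mem_members_iff l _).2.2.2, (scaleAut_coords l u g).2.2.2]

/-- `halfShift k` stabilises `{b = 0}`, `{b = c = 0}`, the rotations and `{e = 1}`. (toy bookkeeping for [EtTh] Prop. 2.6;
no claim about print) [cite: MochizukiEtTh2009, Prop 2.6 p.40] -/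
theorem halfShift_stabilises (hl : Odd l) (k : ZMod 0) :
    ((heisB0 l).comap (PhiT l)).map (halfShift l hl k).toMonoidHom = (heisB0 l).comap (PhiT l) ∧
      ((heisD l).comap (PhiT l)).map (halfShift l hl k).toMonoidHom = (heisD l).comap (PhiT l) ∧
      ((heisPiX l).comap (PhiT l)).map (halfShift l hl k).toMonoidHom = (heisPiX l).comap (PhiT l) ∧
      (PiCdotT l).map (halfShift l hl k).toMonoidHom = PiCdotT l := by
  refine ⟨map_equiv_eq_of_iff _ _ fun g => ?_, map_equiv_eq_of_iff _ _ fun g => ?_,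
    map_equiv_eq_of_iff _ _ fun g => ?_, map_equiv_eq_of_iff _ _ fun g => ?_⟩
  · rw [(mem_members_iff l _).1, (mem_members_iff l _).1, (halfShift_coords l hl k g).2.1]
  · rw [(mem_members_iff l _).2.1, (mem_members_iff l _).2.1, (halfShift_coords l hl k g).2.1,
      (halfShift_coords l hl k g).2.2.1]
    constructor
    · rintro ⟨h1, h2⟩; rw [h1, mul_zero, add_zero] at h2; exact ⟨h1, h2⟩
    · rintro ⟨h1, h2⟩; rw [h1, h2, mul_zero, add_zero]; exact ⟨rfl, rfl⟩
  · rw [(mem_members_iff l _).2.2.1, (mem_members_iff l _).2.2.1, (halfShift_coords l hl k g).1]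
    rcases g.1.right with j | j
    · simp
    · simp only [dihedralShift_sr]
      constructor <;> rintro ⟨i, h⟩ <;> cases h
  · rw [(mem_members_iff l _).2.2.2, (mem_members_iff l _).2.2.2, (halfShift_coords l hl k g).2.2.2]

/-- `conj(ι)` stabilises `{b = 0}`, `{b = c = 0}`, the rotations and `{e = 1}`. (toy bookkeeping for [EtTh] Prop. 2.6;
no claim about print) [cite: MochizukiEtTh2009, Prop 2.6 p.40] -/
theorem conj_iotaT_stabilises :
    ((heisB0 l).comap (PhiT l)).map (MulAut.conj (iotaT l)).toMonoidHom = (heisB0 l).comap (PhiT l) ∧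
      ((heisD l).comap (PhiT l)).map (MulAut.conj (iotaT l)).toMonoidHom = (heisD l).comap (PhiT l) ∧
      ((heisPiX l).comap (PhiT l)).map (MulAut.conj (iotaT l)).toMonoidHom = (heisPiX l).comap (PhiT l) ∧
      (PiCdotT l).map (MulAut.conj (iotaT l)).toMonoidHom = PiCdotT l := by
  refine ⟨map_equiv_eq_of_iff _ _ fun g => ?_, map_equiv_eq_of_iff _ _ fun g => ?_,
    map_equiv_eq_of_iff _ _ fun g => ?_, map_equiv_eq_of_iff _ _ fun g => ?_⟩
  · rw [(mem_members_iff l _).1, (mem_members_iff l _).1, (conj_iotaT_coords l g).2.1, neg_eq_zero]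
  · rw [(mem_members_iff l _).2.1, (mem_members_iff l _).2.1, (conj_iotaT_coords l g).2.1,
      (conj_iotaT_coords l g).2.2.1, neg_eq_zero]
  · rw [(mem_members_iff l _).2.2.1, (mem_members_iff l _).2.2.1, (conj_iotaT_coords l g).1]
    rcases g.1.right with j | j
    · rw [(sr_conj_dihedral j).1]
      exact ⟨fun _ => ⟨j, rfl⟩, fun _ => ⟨-j, rfl⟩⟩
    · rw [(sr_conj_dihedral j).2]
      constructor <;> rintro ⟨i, h⟩ <;> cases h
  · rw [(mem_members_iff l _).2.2.2, (mem_members_iff l _).2.2.2, (conj_iotaT_coords l g).2.2.2]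

/-- `conj(x^a)` stabilises `Π^tp_{X̲} = {b = 0, rotation}` and `{e = 1}` (on rotations it is the twist `c ↦ c − i a`).
(toy bookkeeping for [EtTh] Prop. 2.6; no claim about print) [cite: MochizukiEtTh2009, Prop 2.6 p.40] -/
theorem conj_xElt_stabilises (a : ZMod l) :
    ((heisB0 l ⊓ heisPiX l).comap (PhiT l)).map (MulAut.conj (xElt l a)).toMonoidHom =
        (heisB0 l ⊓ heisPiX l).comap (PhiT l) ∧
      (PiCdotT l).map (MulAut.conj (xElt l a)).toMonoidHom = PiCdotT l := by
  refine ⟨map_equiv_eq_of_iff _ _ fun g => ?_, map_equiv_eq_of_iff _ _ fun g => ?_⟩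
  · rw [Subgroup.comap_inf, Subgroup.mem_inf, Subgroup.mem_inf, (mem_members_iff l _).1, (mem_members_iff l _).1,
      (mem_members_iff l _).2.2.1, (mem_members_iff l _).2.2.1, (conj_xElt_coords l a g).1, (conj_xElt_coords l a g).2.1]
    constructor
    · rintro ⟨h1, j, hj⟩
      rw [hj, dihedralRed_r, eps_r, sub_self, mul_zero, add_zero] at h1
      exact ⟨h1, j, hj⟩
    · rintro ⟨h1, j, hj⟩
      rw [hj, dihedralRed_r, eps_r, sub_self, mul_zero, add_zero, h1]
      exact ⟨rfl, j, rfl⟩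
  · rw [(mem_members_iff l _).2.2.2, (mem_members_iff l _).2.2.2, (conj_xElt_coords l a g).2.2.2]

/-! ## 3. The dotted members as images of `embCu` -/

/-- An element with `b = 0`, `e = 1` is `embCu (c, d)`. (toy bookkeeping for [EtTh] Def. 2.5 (ii); no claim about print)
[cite: MochizukiEtTh2009, Def 2.5(ii) p.39] -/
theorem eq_embCu_of_coords {g : TG l} (hb : bC l g = 0) (he : g.2 = 1) :
    g = embCu l (ofAdd (cC l g), g.1.right) :=
  TG.ext l rfl (by rw [bC_embCu, hb]) (by rw [cC_embCu, toAdd_ofAdd]) (by rw [embCu_snd, he])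

/-- **`Π^tp_{Ċ̲} = embCu(ℤ/l × D_∞)`**. (toy bookkeeping for [EtTh] Def. 2.5 (ii); no claim about print)
[cite: MochizukiEtTh2009, Def 2.5(ii) p.39] -/
theorem range_embCu : (embCu l).range = (heisB0 l).comap (PhiT l) ⊓ PiCdotT l := by
  ext g
  rw [MonoidHom.mem_range, Subgroup.mem_inf, (mem_members_iff l _).1, (mem_members_iff l _).2.2.2]
  constructor
  · rintro ⟨p, rfl⟩; exact ⟨bC_embCu l p, embCu_snd l p⟩
  · rintro ⟨hb, he⟩; exact ⟨_, (eq_embCu_of_coords l hb he).symm⟩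

/-- **`Π^tp_{Ċ̲̲} = embCu(1 × D_∞) ≅ D_∞`**. (toy bookkeeping for [EtTh] Def. 2.5 (ii); no claim about print)
[cite: MochizukiEtTh2009, Def 2.5(ii) p.39] -/
theorem range_embCu_inr :
    ((embCu l).comp (MonoidHom.inr (Multiplicative (ZMod l)) (DihedralGroup 0))).range =
      (heisD l).comap (PhiT l) ⊓ PiCdotT l := by
  ext g
  rw [MonoidHom.mem_range, Subgroup.mem_inf, (mem_members_iff l _).2.1, (mem_members_iff l _).2.2.2]
  constructor
  · rintro ⟨d, rfl⟩; exact ⟨⟨bC_embCu l _, by rw [MonoidHom.comp_apply, cC_embCu]; rfl⟩, embCu_snd l _⟩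
  · rintro ⟨⟨hb, hc⟩, he⟩
    refine ⟨g.1.right, ?_⟩
    rw [MonoidHom.comp_apply, MonoidHom.inr_apply, eq_embCu_of_coords l hb he, hc, embCu_right]
    rfl

/-- **`Π^tp_{Ẋ̲̲} = embCu(1 × ⟨r⟩) ≅ ℤ`**. (toy bookkeeping for [EtTh] Def. 2.5 (ii); no claim about print)
[cite: MochizukiEtTh2009, Def 2.5(ii) p.39] -/
theorem range_embCu_inr_zpowers :
    ((embCu l).comp ((MonoidHom.inr (Multiplicative (ZMod l)) (DihedralGroup 0)).comp
      (zpowersHom (DihedralGroup 0) (r 1)))).range =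
      (heisD l ⊓ heisPiX l).comap (PhiT l) ⊓ PiCdotT l := by
  ext g
  rw [MonoidHom.mem_range, Subgroup.comap_inf, Subgroup.mem_inf, Subgroup.mem_inf, (mem_members_iff l _).2.1,
    (mem_members_iff l _).2.2.1, (mem_members_iff l _).2.2.2]
  constructor
  · rintro ⟨n, rfl⟩
    simp only [MonoidHom.comp_apply, zpowersHom_apply, r_one_zpow, MonoidHom.inr_apply]
    exact ⟨⟨⟨bC_embCu l _, cC_embCu l _⟩, _, rfl⟩, embCu_snd l _⟩
  · rintro ⟨⟨⟨hb, hc⟩, j, hj⟩, he⟩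
    refine ⟨ofAdd (show ℤ from j), ?_⟩
    simp only [MonoidHom.comp_apply, zpowersHom_apply, toAdd_ofAdd, MonoidHom.inr_apply]
    rw [eq_embCu_of_coords l hb he, hc, hj, r_one_zpow]
    rfl

/-- **`Π^tp_{Ẋ̲} = embCu(ℤ/l × ⟨r⟩)`** (membership form). (toy bookkeeping for [EtTh] Def. 2.5 (ii); no claim about print)
[cite: MochizukiEtTh2009, Def 2.5(ii) p.39] -/
theorem mem_dotXu_iff (g : TG l) :
    g ∈ (heisB0 l ⊓ heisPiX l).comap (PhiT l) ⊓ PiCdotT l ↔ ∃ (c : ZMod l) (j : ZMod 0), g = embCu l (ofAdd c, r j) := by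
  rw [Subgroup.comap_inf, Subgroup.mem_inf, Subgroup.mem_inf, (mem_members_iff l _).1, (mem_members_iff l _).2.2.1,
    (mem_members_iff l _).2.2.2]
  constructor
  · rintro ⟨⟨hb, j, hj⟩, he⟩
    exact ⟨cC l g, j, by rw [eq_embCu_of_coords l hb he, hj]; rfl⟩
  · rintro ⟨c, j, rfl⟩
    exact ⟨⟨bC_embCu l _, j, rfl⟩, embCu_snd l _⟩

end Literature.AnabelianGeometry.EtaleTheta.ThetaCovers.MonodromyModel

end
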